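import Literature.Geometry.Lorentzian.KerrRpBulk
import HarnessLib

/-!
# The conformal (radiation-field) form of the wave equation on Kerr: `Ψ = rψ` solves
# `∂_μ(r⁻² g^{μν} ∂_ν Ψ) = 𝒱 Ψ`, `𝒱 = 2(Mr − a²)/(r⁴Σ)`

(family `gr`; infrastructure for the far-region `r^p`-weighted estimates behind statement **gr.S24**
— the named fact `Kerr.dafermosRodnianski_pHierarchy_scri` of `KerrDecayHierarchy.lean` — in the
coefficient-field framework of `KerrSchild.waveOperator`; namespaces
`Literature.Geometry.Lorentzian.KerrSchild`, `Literature.Geometry.Lorentzian.Kerr`)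

Dafermos–Rodnianski run the `r^p` method (arXiv:0910.4957, §3–§4) on the **radiation field**
`Ψ = rψ`, for which the wave equation takes the form `∂_u∂_v Ψ = ∇̸-terms + V Ψ` with a short-range
potential (`V = 0` on Minkowski space, (p-WE-Mink); `V = O(M r⁻³)` in the `(u, v)`-normalisation on
Schwarzschild): the multiplier `r^p ∂_vΨ` then produces the signed bulk
`½ r^{p−1}(p(∂_vΨ)² + (2 − p)|∇̸Ψ|²)` with **no zeroth-order term and no `∂_uΨ ∂_vΨ` cross term**
— whereas the same multiplier applied to `ψ` itself produces the cross term `r^{p−1}(∂_uψ)(∂_vψ)`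
(`Kerr.multiplierBulk_outVector_shearFree`: the term `(1 − 2H)(r/Σ) u v`), whose removal by a
Lagrangian correction `w ψ∂ψ − ½ψ²∂w` costs a zeroth-order bulk term of the wrong sign for `p > 1`.

In the divergence-form framework of the tree the passage `ψ ↦ Ψ = rψ` is a **conformal change of
the coefficient field**: for any symmetric coefficient field `G`, any weight `ω` and
`G̃ = ω⁻² G`,
`□_{G̃}(ωΦ) = ω⁻¹ □_G Φ + 𝒱_ω · (ωΦ)`, `𝒱_ω = ω⁻³ □_G ω − 2ω⁻⁴ G(dω, dω)`
(`KerrSchild.waveOperator_conformal`; for a metric with `det g = −1` and `ω = Ω⁻¹` this is the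
conformal covariance of the wave operator, `G̃` being `|g̃|^{1/2} g̃^{μν}` for `g̃ = Ω²g` up to the
factor `Ω²`). For Kerr in the Kerr–Schild chart and `ω = r` (the Kerr–Schild radius):

* `Kerr.sum_sum_inverseMetric_mul_fderiv_radius` — `g⁻¹(dr, dr) = Δ_r/Σ`, `Δ_r = r² − 2Mr + a²`
  (the Boyer–Lindquist `g^{rr}`);
* `Kerr.waveOperator_radius` — **`□_g r = 2(r − M)/Σ`** (from `Δ_flat r = 2r/Σ`,
  `∂²_{ℓ♯ℓ♯} r = 0`, `∂_{ℓ♯} r = 1`, `∂_{ℓ♯}H + 2Hr/Σ = M/Σ`);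
* `Kerr.confInverseMetric M a = r⁻² g⁻¹_{M,a}`, `Kerr.confPotential M a = 𝒱 = 2(Mr − a²)/(r⁴Σ)`
  (`= 2M/r⁵` for `a = 0`; `O(M r⁻⁵)`: short range), and
  `Kerr.waveOperator_confInverseMetric_radius_mul` — **`□_{r⁻²g⁻¹}(rΦ) = r⁻¹ □_g Φ + 𝒱 · rΦ`**
  for every `Φ` of class `C²` at a point with `r > 0`; in particular
  (`Kerr.waveOperator_confInverseMetric_radius_mul_eq_of_wave`) **if `□_g Φ = 0` at `x` then
  `Ψ = rΦ` satisfies `□_{r⁻²g⁻¹} Ψ = 𝒱 Ψ` at `x`**;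
* the bookkeeping for the multiplier currents of `KerrSchildMultiplierCurrent.lean` under the
  conformal weight: `KerrSchild.multiplierCurrent_conformal` (`J^X[φG] = φ J^X[G]`, pointwise in
  `dw`) — together with `KerrSchild.multiplierBulk_conformal` of `KerrRpBulk.lean`
  (`K^X[φG] = φ K^X[G] − ½ X(φ) G(dw, dw)`), and for `φ = r⁻²`, `X = f(r) m`:
  `K^{fm}[r⁻²g⁻¹] = r⁻² (K^{fm}[g⁻¹] + (1 − 2H) (f/r) g⁻¹(dw, dw))`
  (`Kerr.multiplierBulk_confInverseMetric_radial_smul_outVector`): the conformal weight adds exactly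
  the Lagrangian-type term `(1 − 2H)(f/r)(−uv + |p̸|²)` that cancels the `u v` cross term of
  `K^{fm}` up to `O(a² f r⁻³) u v` and turns the `|p̸|²`-coefficient into
  `(1 − 2H)(f/r − ½f′) + f ∂_{ℓ♯}H` (`= ½(2 − p) r^{p−1} + O(M r^{p−2})` for `f = r^p`), with no
  zeroth-order term at all — the structure of (p-WE-Mink)/(p-WE-Schw).

All statements are pointwise identities for all real `M, a` at points with `r > 0`; no named facts
(D-0026).

## References

* M. Dafermos, I. Rodnianski, *A new physical-space approach to decay for the wave equation with
  applications to black hole spacetimes*, XVIth ICMP (2010), arXiv:0910.4957, §3–§4 (the equation for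
  `Ψ = rψ`, (p-WE-Mink), (p-WE-Schw)) (key `DafermosRodnianski2010ICMP`).
* G. Moschidis, arXiv:1509.08489 = Ann. PDE 2 (2016), §5 (the `r^p` method for `Ωφ`,
  `Ω = r(1 + O(r⁻¹))`) (key `Moschidis2016`).
* R. M. Wald, *General Relativity* (1984), App. D, (D.13) (conformal covariance of `□ − R/6`)
  (key `Wald1984`).
* M. Visser, arXiv:0706.0622, (33)–(36), §5 (key `arXiv07060622`).
-/

noncomputable section

open Set Filter
open scoped Topology

namespace Literature.Geometry.Lorentzian

/-! ### The conformal change of the coefficient field in the divergence-form operator -/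

namespace KerrSchild

variable {G : E4 → Fin 4 → Fin 4 → ℝ} {x : E4}

/-- **`J^X[φ G] = φ J^X[G]`**: the multiplier current is `C⁰`-linear in the coefficient field.
[folklore] -/
theorem multiplierCurrent_conformal (G : E4 → Fin 4 → Fin 4 → ℝ) (φ : E4 → ℝ) (X : E4 → Fin 4 → ℝ)
    (w : E4 → ℝ) (x : E4) (μ : Fin 4) :
    multiplierCurrent (fun y α β ↦ φ y * G y α β) X w x μ = φ x * multiplierCurrent G X w x μ := by
  simp only [multiplierCurrent, mul_assoc, ← Finset.mul_sum]
  ring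

/-- The raised gradient `A^μ_F = ∑_ν G^{μν} ∂_νF` of a `C²` function is differentiable, for a
coefficient field differentiable at the point. [folklore] -/
theorem differentiableAt_sum_mul_fderiv (hG : ∀ μ ν, DifferentiableAt ℝ (fun y ↦ G y μ ν) x)
    {F : E4 → ℝ} (hF : ContDiffAt ℝ 2 F x) (μ : Fin 4) :
    DifferentiableAt ℝ (fun y ↦ ∑ ν, G y μ ν * fderiv ℝ F y (E4.basisVector ν)) x := by
  have hF2 : DifferentiableAt ℝ (fderiv ℝ F) x :=
    (hF.fderiv_right (m := 1) le_rfl).differentiableAt one_ne_zero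
  have hdP : ∀ κ, DifferentiableAt ℝ (fun y ↦ fderiv ℝ F y (E4.basisVector κ)) x := fun κ ↦
    hF2.clm_apply (differentiableAt_const _)
  exact DifferentiableAt.fun_sum fun ν _ ↦ (hG μ ν).mul (hdP ν)

/-- **Conformal change of the coefficient field in the divergence-form wave operator.** Let `G` be a
coefficient field symmetric near `x` and differentiable at `x`, `ω` and `Φ` of class `C²` at `x` with
`ω(x) ≠ 0`. Then, with `G̃ = ω⁻² G`,
`□_{G̃}(ωΦ)(x) = ω⁻¹ □_G Φ (x) + (ω⁻³ □_G ω − 2 ω⁻⁴ ∑ G^{αβ}∂_αω ∂_βω)(x) · ω(x)Φ(x)`.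
Proof: near `x`, `∑_ν G̃^{μν}∂_ν(ωΦ) = ω⁻¹ A^μ_Φ + ω⁻² Φ A^μ_ω` (`A_F = G dF`); differentiate with the
product rule and use `∑_μ ∂_μ A^μ_F = □_G F` and the symmetry `∑_μ ∂_μω A^μ_Φ = ∑_μ ∂_μΦ A^μ_ω`.
(For `ω = Ω⁻¹` and `det g = −1` this is the conformal covariance
`(□_g − R/6)ψ = Ω³(□_{Ω²g} − R̃/6)(Ω⁻¹ψ)`, Wald 1984, (D.13), in divergence form.) [cite: Wald1984, App. D (D.13)] -/
theorem waveOperator_conformal (hG : ∀ μ ν, DifferentiableAt ℝ (fun y ↦ G y μ ν) x)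
    (hsymm : ∀ᶠ y in 𝓝 x, ∀ μ ν, G y μ ν = G y ν μ) {ω Φ : E4 → ℝ} (hω : ContDiffAt ℝ 2 ω x)
    (hΦ : ContDiffAt ℝ 2 Φ x) (hω0 : ω x ≠ 0) :
    waveOperator (fun y α β ↦ (ω y ^ 2)⁻¹ * G y α β) (fun y ↦ ω y * Φ y) x =
      (ω x)⁻¹ * waveOperator G Φ x +
        ((ω x ^ 3)⁻¹ * waveOperator G ω x -
          2 * (ω x ^ 4)⁻¹ * ∑ α, ∑ β, G x α β * fderiv ℝ ω x (E4.basisVector α) *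
            fderiv ℝ ω x (E4.basisVector β)) * (ω x * Φ x) := by
  -- differentiability facts
  have hω1 : DifferentiableAt ℝ ω x := hω.differentiableAt two_ne_zero
  have hΦ1 : DifferentiableAt ℝ Φ x := hΦ.differentiableAt two_ne_zero
  have hωev : ∀ᶠ y in 𝓝 x, ω y ≠ 0 := hω1.continuousAt.eventually_ne hω0
  have hω1ev : ∀ᶠ y in 𝓝 x, DifferentiableAt ℝ ω y :=
    (hω.eventually (by simp)).mono fun y hy ↦ hy.differentiableAt two_ne_zero
  have hΦ1ev : ∀ᶠ y in 𝓝 x, DifferentiableAt ℝ Φ y :=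
    (hΦ.eventually (by simp)).mono fun y hy ↦ hy.differentiableAt two_ne_zero
  set AΦ : Fin 4 → E4 → ℝ := fun μ y ↦ ∑ ν, G y μ ν * fderiv ℝ Φ y (E4.basisVector ν) with hAΦ
  set Aω : Fin 4 → E4 → ℝ := fun μ y ↦ ∑ ν, G y μ ν * fderiv ℝ ω y (E4.basisVector ν) with hAω
  have hAΦd : ∀ μ, DifferentiableAt ℝ (AΦ μ) x := fun μ ↦ differentiableAt_sum_mul_fderiv hG hΦ μ
  have hAωd : ∀ μ, DifferentiableAt ℝ (Aω μ) x := fun μ ↦ differentiableAt_sum_mul_fderiv hG hω μ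
  -- the inner functions, near `x`
  have hinner : ∀ μ, (fun y ↦ ∑ ν, (ω y ^ 2)⁻¹ * G y μ ν *
      fderiv ℝ (fun z ↦ ω z * Φ z) y (E4.basisVector ν)) =ᶠ[𝓝 x]
      fun y ↦ (ω y)⁻¹ * AΦ μ y + (ω y)⁻¹ * (ω y)⁻¹ * Φ y * Aω μ y := by
    intro μ
    filter_upwards [hωev, hω1ev, hΦ1ev] with y hy hωy hΦy
    have hprod : fderiv ℝ (fun z ↦ ω z * Φ z) y = ω y • fderiv ℝ Φ y + Φ y • fderiv ℝ ω y :=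
      fderiv_mul hωy hΦy
    simp only [hprod, add_apply, smul_apply, smul_eq_mul, hAΦ, hAω, Finset.mul_sum,
      ← Finset.sum_add_distrib]
    refine Finset.sum_congr rfl fun ν _ ↦ ?_
    field_simp
  -- differentiate
  rw [waveOperator_apply]
  have hinv1 : HasFDerivAt (fun y ↦ (ω y)⁻¹) (-(ω x ^ 2)⁻¹ • fderiv ℝ ω x) x := by
    have := (hasDerivAt_inv hω0).comp_hasFDerivAt x hω1.hasFDerivAt
    simpa [Function.comp_def] using this
  have hderiv : ∀ μ, fderiv ℝ (fun y ↦ ∑ ν, (ω y ^ 2)⁻¹ * G y μ ν *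
      fderiv ℝ (fun z ↦ ω z * Φ z) y (E4.basisVector ν)) x (E4.basisVector μ) =
      (-(ω x ^ 2)⁻¹) * (fderiv ℝ ω x (E4.basisVector μ) * AΦ μ x) +
        (ω x)⁻¹ * fderiv ℝ (AΦ μ) x (E4.basisVector μ) +
      ((-2 * ((ω x)⁻¹ * (ω x ^ 2)⁻¹) * Φ x) * (fderiv ℝ ω x (E4.basisVector μ) * Aω μ x) +
        ((ω x)⁻¹ * (ω x)⁻¹) * (fderiv ℝ Φ x (E4.basisVector μ) * Aω μ x) +
        ((ω x)⁻¹ * (ω x)⁻¹ * Φ x) * fderiv ℝ (Aω μ) x (E4.basisVector μ)) := by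
    intro μ
    rw [(hinner μ).fderiv_eq]
    have h1 : HasFDerivAt (fun y ↦ (ω y)⁻¹ * AΦ μ y)
        ((ω x)⁻¹ • fderiv ℝ (AΦ μ) x + AΦ μ x • (-(ω x ^ 2)⁻¹ • fderiv ℝ ω x)) x :=
      hinv1.mul (hAΦd μ).hasFDerivAt
    have h2 : HasFDerivAt (fun y ↦ (ω y)⁻¹ * (ω y)⁻¹ * Φ y * Aω μ y)
        (((ω x)⁻¹ * (ω x)⁻¹ * Φ x) • fderiv ℝ (Aω μ) x +
          Aω μ x • (((ω x)⁻¹ * (ω x)⁻¹) • fderiv ℝ Φ x +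
            Φ x • ((ω x)⁻¹ • (-(ω x ^ 2)⁻¹ • fderiv ℝ ω x) +
              (ω x)⁻¹ • (-(ω x ^ 2)⁻¹ • fderiv ℝ ω x)))) x :=
      ((hinv1.mul hinv1).mul hΦ1.hasFDerivAt).mul (hAωd μ).hasFDerivAt
    have h12 : HasFDerivAt (fun y ↦ (ω y)⁻¹ * AΦ μ y + (ω y)⁻¹ * (ω y)⁻¹ * Φ y * Aω μ y)
        ((ω x)⁻¹ • fderiv ℝ (AΦ μ) x + AΦ μ x • (-(ω x ^ 2)⁻¹ • fderiv ℝ ω x) +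
          (((ω x)⁻¹ * (ω x)⁻¹ * Φ x) • fderiv ℝ (Aω μ) x +
            Aω μ x • (((ω x)⁻¹ * (ω x)⁻¹) • fderiv ℝ Φ x +
              Φ x • ((ω x)⁻¹ • (-(ω x ^ 2)⁻¹ • fderiv ℝ ω x) +
                (ω x)⁻¹ • (-(ω x ^ 2)⁻¹ • fderiv ℝ ω x))))) x := h1.add h2
    rw [h12.fderiv]
    simp only [add_apply, smul_apply, smul_eq_mul, neg_mul]
    ring
  simp only [hderiv, Finset.sum_add_distrib, ← Finset.mul_sum]
  -- identify the divergences and use the symmetry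
  have hdivΦ : ∑ μ, fderiv ℝ (AΦ μ) x (E4.basisVector μ) = waveOperator G Φ x := by
    rw [waveOperator_apply]
  have hdivω : ∑ μ, fderiv ℝ (Aω μ) x (E4.basisVector μ) = waveOperator G ω x := by
    rw [waveOperator_apply]
  have hsymm_x : ∀ μ ν, G x μ ν = G x ν μ := hsymm.self_of_nhds
  have hswap : ∑ μ, fderiv ℝ ω x (E4.basisVector μ) * AΦ μ x =
      ∑ μ, fderiv ℝ Φ x (E4.basisVector μ) * Aω μ x := by
    simp only [hAΦ, hAω, Finset.mul_sum]
    rw [Finset.sum_comm]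
    refine Finset.sum_congr rfl fun μ _ ↦ Finset.sum_congr rfl fun ν _ ↦ ?_
    rw [hsymm_x ν μ]
    ring
  have hωω : ∑ μ, fderiv ℝ ω x (E4.basisVector μ) * Aω μ x =
      ∑ α, ∑ β, G x α β * fderiv ℝ ω x (E4.basisVector α) * fderiv ℝ ω x (E4.basisVector β) := by
    simp only [hAω, Finset.mul_sum]
    refine Finset.sum_congr rfl fun μ _ ↦ Finset.sum_congr rfl fun ν _ ↦ by ring
  rw [hdivΦ, hdivω, hswap, hωω]
  field_simp
  ring

end KerrSchild

/-! ### Kerr: `g⁻¹(dr, dr) = Δ_r/Σ`, `□_g r = 2(r − M)/Σ`, and the conformal coefficient field -/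

namespace Kerr

variable {M a : ℝ} {x : E4}

/-- **`g⁻¹(dr, dr) = Δ_r/Σ`**, `Δ_r = r² − 2Mr + a²` (the Boyer–Lindquist component `g^{rr}`): in the
null frame `g⁻¹(dr, dr) = −dr(m) dr(k) + |∇̸r|² = (1 − 2H) + (|∇r|² − 1)` with
`|∇r|² = (r² + a²)/Σ` (`Kerr.sum_sq_fderiv_radius`) and `H = Mr/Σ`. [cite: arXiv07060622, (35)] -/
theorem sum_sum_inverseMetric_mul_fderiv_radius (M a : ℝ) (hx : 0 < radius a x) :
    ∑ α, ∑ β, inverseMetric M a x α β * fderiv ℝ (radius a) x (E4.basisVector α) *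
        fderiv ℝ (radius a) x (E4.basisVector β) =
      (radius a x ^ 2 - 2 * M * radius a x + a ^ 2) / blSigma a (E4.spatial x) := by
  have hS : blSigma a (E4.spatial x) ≠ 0 := (blSigma_spatial_pos hx).ne'
  rw [sum_inverseMetric_mul_mul_self_eq_frame, frameOut_fderiv_radius M a hx, frameIn_fderiv_radius hx,
    frameAngSq, spatialDotNull_eq_frame M a x, frameOut_fderiv_radius M a hx, frameIn_fderiv_radius hx,
    sum_sq_fderiv_radius hx, scalarH_eq_div_blSigma M a hx]
  field_simp
  ring

/-- `∂_{t*}(∂_{t*} r) = 0`: the time derivative of the radius vanishes identically on `{r > 0}`.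
[folklore] -/
theorem fderiv_fderiv_radius_basisVector_zero (a : ℝ) (hx : 0 < radius a x) :
    fderiv ℝ (fun y ↦ fderiv ℝ (radius a) y (E4.basisVector 0)) x (E4.basisVector 0) = 0 := by
  have hev : (fun y ↦ fderiv ℝ (radius a) y (E4.basisVector 0)) =ᶠ[𝓝 x] fun _ ↦ (0 : ℝ) := by
    have hopen : IsOpen {y : E4 | 0 < radius a y} := isOpen_lt continuous_const (continuous_radius a)
    filter_upwards [hopen.mem_nhds hx] with y hy
    exact fderiv_radius_basisVector_zero a hy
  rw [hev.fderiv_eq]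
  simp

/-- **`□_g r = 2(r − M)/Σ` on Kerr.** Near a point with `r > 0`,
`∑_ν g^{μν}∂_νr = η^{μμ}∂_μr − 2H ℓ^μ` (`∂_{ℓ♯} r = 1`), so
`□_g r = Δ_flat r − ∂_{t*}²r − 2(∂_{ℓ♯}H + H ∑∂_μℓ^μ) = 2r/Σ − 0 − 2M/Σ`
(`Δ_flat r = 2r/Σ`, `Kerr.laplacian_radius`; `∂_{ℓ♯}H = M(Σ − 2r²)/Σ²`, `∑∂_μℓ^μ = 2r/Σ`, `H = Mr/Σ`).
For `a = 0`: `□_g r = 2(r − M)/r²`, the familiar `□ r = (2/r)(1 − M/r)` of Schwarzschild in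
regular coordinates. [cite: arXiv07060622, §5] -/
theorem waveOperator_radius (M a : ℝ) (hx : 0 < radius a x) :
    KerrSchild.waveOperator (inverseMetric M a) (radius a) x =
      2 * (radius a x - M) / blSigma a (E4.spatial x) := by
  have hr : radius a x ≠ 0 := hx.ne'
  have hS : blSigma a (E4.spatial x) ≠ 0 := (blSigma_spatial_pos hx).ne'
  have hopen : IsOpen {y : E4 | 0 < radius a y} := isOpen_lt continuous_const (continuous_radius a)
  -- the inner functions near `x`
  have hinner : ∀ μ, (fun y ↦ ∑ ν, inverseMetric M a y μ ν * fderiv ℝ (radius a) y (E4.basisVector ν))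
      =ᶠ[𝓝 x] fun y ↦ (if μ = 0 then -1 else 1) * fderiv ℝ (radius a) y (E4.basisVector μ) -
        2 * (scalarH M a y * nullVector a y μ) := by
    intro μ
    filter_upwards [hopen.mem_nhds hx] with y hy
    simp only [inverseMetric_apply, sub_mul, Finset.sum_sub_distrib]
    have h1 : ∑ ν, (if μ = ν then (if μ = 0 then (-1 : ℝ) else 1) else 0) *
        fderiv ℝ (radius a) y (E4.basisVector ν) =
        (if μ = 0 then -1 else 1) * fderiv ℝ (radius a) y (E4.basisVector μ) := by
      rw [Finset.sum_eq_single μ (fun ν _ hν ↦ by rw [if_neg (Ne.symm hν), zero_mul])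
        (fun h ↦ (h (Finset.mem_univ μ)).elim), if_pos rfl]
    have h2 : ∑ ν, 2 * scalarH M a y * nullVector a y ν * nullVector a y μ *
        fderiv ℝ (radius a) y (E4.basisVector ν) = 2 * (scalarH M a y * nullVector a y μ) *
          ∑ ν, nullVector a y ν * fderiv ℝ (radius a) y (E4.basisVector ν) := by
      rw [Finset.mul_sum]; exact Finset.sum_congr rfl fun ν _ ↦ by ring
    rw [h1, h2, sum_nullVector_mul_fderiv_basisVector, fderiv_radius_nullVector hy, mul_one]
  have hH : DifferentiableAt ℝ (scalarH M a) x :=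
    (contDiffAt_scalarH M a hx (n := 1)).differentiableAt one_ne_zero
  have hl : ∀ μ, DifferentiableAt ℝ (fun y ↦ nullVector a y μ) x := fun μ ↦
    (contDiffAt_nullVector_apply a hx (n := 1) μ).differentiableAt one_ne_zero
  have hdr : ∀ μ, DifferentiableAt ℝ (fun y ↦ fderiv ℝ (radius a) y (E4.basisVector μ)) x := fun μ ↦
    differentiableAt_fderiv_radius_apply hx _
  have hderiv : ∀ μ, fderiv ℝ (fun y ↦ ∑ ν, inverseMetric M a y μ ν *
      fderiv ℝ (radius a) y (E4.basisVector ν)) x (E4.basisVector μ) =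
      (if μ = 0 then -1 else 1) *
          fderiv ℝ (fun y ↦ fderiv ℝ (radius a) y (E4.basisVector μ)) x (E4.basisVector μ) -
        2 * (fderiv ℝ (scalarH M a) x (E4.basisVector μ) * nullVector a x μ +
          scalarH M a x * fderiv ℝ (fun y ↦ nullVector a y μ) x (E4.basisVector μ)) := by
    intro μ
    rw [(hinner μ).fderiv_eq]
    have h : HasFDerivAt (fun y ↦ (if μ = 0 then -1 else (1 : ℝ)) * fderiv ℝ (radius a) y (E4.basisVector μ) -
        2 * (scalarH M a y * nullVector a y μ))
        ((if μ = 0 then -1 else (1 : ℝ)) • fderiv ℝ (fun y ↦ fderiv ℝ (radius a) y (E4.basisVector μ)) x -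
          (2 : ℝ) • (scalarH M a x • fderiv ℝ (fun y ↦ nullVector a y μ) x +
            nullVector a x μ • fderiv ℝ (scalarH M a) x)) x :=
      ((hdr μ).hasFDerivAt.const_mul _).sub ((hH.hasFDerivAt.mul (hl μ).hasFDerivAt).const_mul 2)
    rw [h.fderiv]
    simp only [sub_apply, smul_apply, add_apply, smul_eq_mul]
    ring
  rw [KerrSchild.waveOperator_apply]
  simp only [hderiv, Finset.sum_sub_distrib, mul_add, Finset.sum_add_distrib]
  -- the flat d'Alembertian of `r`: `−∂₀²r + Δr`
  have hflat : ∑ μ, (if μ = 0 then -1 else (1 : ℝ)) *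
      fderiv ℝ (fun y ↦ fderiv ℝ (radius a) y (E4.basisVector μ)) x (E4.basisVector μ) =
      2 * radius a x / blSigma a (E4.spatial x) := by
    rw [Fin.sum_univ_succ, if_pos rfl, fderiv_fderiv_radius_basisVector_zero a hx, mul_zero, zero_add]
    simp only [if_neg (Fin.succ_ne_zero _), one_mul]
    exact laplacian_radius hx
  have hH1 : ∑ μ, 2 * (fderiv ℝ (scalarH M a) x (E4.basisVector μ) * nullVector a x μ) =
      2 * fderiv ℝ (scalarH M a) x (nullVector a x) := by
    rw [← Finset.mul_sum, ← sum_nullVector_mul_fderiv_basisVector a x]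
    congr 1
    exact Finset.sum_congr rfl fun μ _ ↦ by ring
  have hH2 : ∑ μ, 2 * (scalarH M a x * fderiv ℝ (fun y ↦ nullVector a y μ) x (E4.basisVector μ)) =
      2 * scalarH M a x * (2 * radius a x / blSigma a (E4.spatial x)) := by
    rw [← sum_fderiv_nullVector_basisVector hx, Finset.mul_sum]
    exact Finset.sum_congr rfl fun μ _ ↦ by ring
  rw [hflat, hH1, hH2, fderiv_scalarH_nullVector M hx, scalarH_eq_div_blSigma M a hx]
  field_simp
  ring

/-- The **conformal inverse metric** `r⁻² g⁻¹_{M,a}` of the Kerr–Schild chart: the coefficient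
field of the divergence-form equation satisfied by the radiation field `Ψ = rψ`
(`Kerr.waveOperator_confInverseMetric_radius_mul`). [cite: DafermosRodnianski2010ICMP, §3–§4] -/
def confInverseMetric (M a : ℝ) (x : E4) (μ ν : Fin 4) : ℝ :=
  (radius a x ^ 2)⁻¹ * inverseMetric M a x μ ν

/-- The **potential of the radiation-field equation** on Kerr:
`𝒱 = 2(Mr − a²)/(r⁴ Σ)` (`= 2M/r⁵` for `a = 0`). [cite: DafermosRodnianski2010ICMP, §4] -/
def confPotential (M a : ℝ) (x : E4) : ℝ :=
  2 * (M * radius a x - a ^ 2) / (radius a x ^ 4 * blSigma a (E4.spatial x))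

/-- The conformal inverse metric is symmetric. [folklore] -/
theorem confInverseMetric_symm (M a : ℝ) (x : E4) (μ ν : Fin 4) :
    confInverseMetric M a x μ ν = confInverseMetric M a x ν μ := by
  rw [confInverseMetric, confInverseMetric, inverseMetric_symm]

/-- The conformal inverse metric is `C^n` wherever `r > 0`. [folklore] -/
theorem contDiffAt_confInverseMetric (M a : ℝ) (hx : 0 < radius a x) (μ ν : Fin 4)
    {n : WithTop ℕ∞} : ContDiffAt ℝ n (fun y ↦ confInverseMetric M a y μ ν) x := by
  unfold confInverseMetric
  exact ((contDiffAt_radius hx).pow 2).inv (pow_ne_zero 2 hx.ne') |>.mul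
    (contDiffAt_inverseMetric M a hx μ ν)

/-- `𝒱 = r⁻³ □_g r − 2 r⁻⁴ g⁻¹(dr, dr)`: the potential is the one of
`KerrSchild.waveOperator_conformal` for `ω = r`. [cite: DafermosRodnianski2010ICMP, §4] -/
theorem confPotential_eq (M a : ℝ) (hx : 0 < radius a x) :
    confPotential M a x = (radius a x ^ 3)⁻¹ * KerrSchild.waveOperator (inverseMetric M a) (radius a) x -
      2 * (radius a x ^ 4)⁻¹ * ∑ α, ∑ β, inverseMetric M a x α β *
        fderiv ℝ (radius a) x (E4.basisVector α) * fderiv ℝ (radius a) x (E4.basisVector β) := by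
  have hr : radius a x ≠ 0 := hx.ne'
  have hS : blSigma a (E4.spatial x) ≠ 0 := (blSigma_spatial_pos hx).ne'
  rw [confPotential, waveOperator_radius M a hx, sum_sum_inverseMetric_mul_fderiv_radius M a hx]
  field_simp
  ring

/-- **The radiation-field equation on Kerr.** For `Φ` of class `C²` at a point `x` with `r > 0`,
`□_{r⁻²g⁻¹}(rΦ)(x) = r⁻¹ □_g Φ (x) + 𝒱(x) · r(x)Φ(x)`, `𝒱 = 2(Mr − a²)/(r⁴Σ)`
(`KerrSchild.waveOperator_conformal` with `ω = r`, `□_g r = 2(r − M)/Σ`, `g⁻¹(dr,dr) = Δ_r/Σ`).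
[cite: DafermosRodnianski2010ICMP, §3–§4] -/
theorem waveOperator_confInverseMetric_radius_mul (M a : ℝ) (hx : 0 < radius a x) {Φ : E4 → ℝ}
    (hΦ : ContDiffAt ℝ 2 Φ x) :
    KerrSchild.waveOperator (confInverseMetric M a) (fun y ↦ radius a y * Φ y) x =
      (radius a x)⁻¹ * KerrSchild.waveOperator (inverseMetric M a) Φ x +
        confPotential M a x * (radius a x * Φ x) := by
  have hG : ∀ μ ν, DifferentiableAt ℝ (fun y ↦ inverseMetric M a y μ ν) x := fun μ ν ↦
    (contDiffAt_inverseMetric M a hx μ ν (n := 1)).differentiableAt one_ne_zero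
  have hsymm : ∀ᶠ y in 𝓝 x, ∀ μ ν, inverseMetric M a y μ ν = inverseMetric M a y ν μ :=
    Eventually.of_forall fun y μ ν ↦ inverseMetric_symm M a y μ ν
  have h := KerrSchild.waveOperator_conformal hG hsymm (contDiffAt_radius hx) hΦ hx.ne'
  rw [confPotential_eq M a hx]
  exact h

/-- **If `□_g Φ = 0` at `x` then `Ψ = rΦ` solves `□_{r⁻²g⁻¹} Ψ = 𝒱 Ψ` at `x`.**
[cite: DafermosRodnianski2010ICMP, §3–§4] -/
theorem waveOperator_confInverseMetric_radius_mul_eq_of_wave (M a : ℝ) (hx : 0 < radius a x)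
    {Φ : E4 → ℝ} (hΦ : ContDiffAt ℝ 2 Φ x)
    (hwave : KerrSchild.waveOperator (inverseMetric M a) Φ x = 0) :
    KerrSchild.waveOperator (confInverseMetric M a) (fun y ↦ radius a y * Φ y) x =
      confPotential M a x * (radius a x * Φ x) := by
  rw [waveOperator_confInverseMetric_radius_mul M a hx hΦ, hwave, mul_zero, zero_add]

/-! ### The multiplier currents and the `r^p` bulk under the conformal weight -/

/-- `J^X[r⁻²g⁻¹] = r⁻² J^X[g⁻¹]`. [folklore] -/
theorem multiplierCurrent_confInverseMetric (M a : ℝ) (X : E4 → Fin 4 → ℝ) (w : E4 → ℝ) (x : E4)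
    (μ : Fin 4) :
    KerrSchild.multiplierCurrent (confInverseMetric M a) X w x μ =
      (radius a x ^ 2)⁻¹ * KerrSchild.multiplierCurrent (inverseMetric M a) X w x μ :=
  KerrSchild.multiplierCurrent_conformal (inverseMetric M a) (fun y ↦ (radius a y ^ 2)⁻¹) X w x μ

/-- **The bulk of `X = f(r) m` for the conformal field `r⁻² g⁻¹`**:
`K^{fm}[r⁻²g⁻¹] = r⁻² (K^{fm}[g⁻¹] + (1 − 2H)(f/r) g⁻¹(dw, dw))`
(`KerrSchild.multiplierBulk_conformal` with `X(r⁻²) = f · dr⁻²(m) = −2 r⁻³ (1 − 2H) f`).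
With `Kerr.multiplierBulk_radial_smul_outVector`, `Kerr.multiplierBulk_outVector` and the
shear-freeness (`KerrNullShearFree.lean`) this gives, in the frame functionals of `dw`,
`r² K^{fm}[r⁻²g⁻¹] = ½ f′ u² + ((1 − 2H)(f/r − ½ f′) + f H_ℓ)|p̸|² + (1 − 2H) f (r/Σ − 1/r) u v
  + f′ u (p̸·∇̸r) + 2 f v (p̸·∇̸H)`. [cite: DafermosRodnianski2010ICMP, §3–§4] -/
theorem multiplierBulk_confInverseMetric_radial_smul_outVector (M a : ℝ) (hx : 0 < radius a x)
    (f : ℝ → ℝ) (w : E4 → ℝ) :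
    KerrSchild.multiplierBulk (confInverseMetric M a) (fun y μ ↦ f (radius a y) * outVector M a y μ) w x =
      (radius a x ^ 2)⁻¹ *
        (KerrSchild.multiplierBulk (inverseMetric M a) (fun y μ ↦ f (radius a y) * outVector M a y μ) w x +
          (1 - 2 * scalarH M a x) * (f (radius a x) / radius a x) *
            ∑ α, ∑ β, inverseMetric M a x α β * fderiv ℝ w x (E4.basisVector α) *
              fderiv ℝ w x (E4.basisVector β)) := by
  have hr : radius a x ≠ 0 := hx.ne'
  have hG : ∀ α β, DifferentiableAt ℝ (fun y ↦ inverseMetric M a y α β) x := fun α β ↦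
    (contDiffAt_inverseMetric M a hx α β (n := 1)).differentiableAt one_ne_zero
  have hrd : DifferentiableAt ℝ (radius a) x := (contDiffAt_radius hx (n := 1)).differentiableAt one_ne_zero
  have hinv : HasFDerivAt (fun y ↦ (radius a y)⁻¹) (-(radius a x ^ 2)⁻¹ • fderiv ℝ (radius a) x) x := by
    have := (hasDerivAt_inv hr).comp_hasFDerivAt x hrd.hasFDerivAt
    simpa [Function.comp_def] using this
  have hsq : HasFDerivAt (fun y ↦ (radius a y ^ 2)⁻¹)
      ((radius a x)⁻¹ • (-(radius a x ^ 2)⁻¹ • fderiv ℝ (radius a) x) +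
        (radius a x)⁻¹ • (-(radius a x ^ 2)⁻¹ • fderiv ℝ (radius a) x)) x := by
    have h := hinv.mul hinv
    refine h.congr_of_eventuallyEq (Eventually.of_forall fun y ↦ ?_)
    simp [sq]
  have hφ : DifferentiableAt ℝ (fun y ↦ (radius a y ^ 2)⁻¹) x := hsq.differentiableAt
  have hφ' : ∀ v, fderiv ℝ (fun y ↦ (radius a y ^ 2)⁻¹) x v =
      -2 * ((radius a x)⁻¹ * (radius a x ^ 2)⁻¹) * fderiv ℝ (radius a) x v := by
    intro v
    rw [hsq.fderiv]
    simp only [add_apply, smul_apply, smul_eq_mul]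
    ring
  have h := KerrSchild.multiplierBulk_conformal (inverseMetric M a)
    (fun y μ ↦ f (radius a y) * outVector M a y μ) w hφ hG
  rw [show confInverseMetric M a = fun y α β ↦ (radius a y ^ 2)⁻¹ * inverseMetric M a y α β from rfl, h]
  simp only [hφ']
  have hX : ∑ μ, f (radius a x) * outVector M a x μ * (-2 * ((radius a x)⁻¹ * (radius a x ^ 2)⁻¹) *
      fderiv ℝ (radius a) x (E4.basisVector μ)) =
      -2 * ((radius a x)⁻¹ * (radius a x ^ 2)⁻¹) * f (radius a x) *
        ∑ μ, outVector M a x μ * fderiv ℝ (radius a) x (E4.basisVector μ) := by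
    rw [Finset.mul_sum]; exact Finset.sum_congr rfl fun μ _ ↦ by ring
  rw [hX, sum_outVector_mul_fderiv_radius M a hx]
  field_simp
  ring

end Kerr

end Literature.Geometry.Lorentzian
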